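import Summits.NavierStokesRegularity.FluidComputer.PalasekTowerRegister
import Summits.NavierStokesRegularity.FluidComputer.PalasekTowerViscosity
import Literature.Analysis.FluidPDE.TaoForcedUniquenessSchwartzForce

/-!
# REGISTER v2.2 for the split children: the QUIET schedule class (`f ≡ 0` from `τ₁` on)

Cell `ns-blowup`; typist `ns-blowup-lean` (g2) for planner `ns-blowup-plan` (g16), WORD K45 (STATUS
l.1252; refuter K45 «K2R∀ adversarial-force budget»). LABEL: E–C typing (KERNEL vocabulary + glue).
WHAT THIS IS NOT: not Navier–Stokes evidence — one schedule predicate, two NAMED open `Prop`s at the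
registered parameters, the assembly and the closer; nothing is inhabited or asserted.

The autonomy bet of REGISTER v2.1 (planner l.1015/l.1039: after `τ₁` the admissible force is a
nuisance, never a resource) becomes a CLAUSE: `Schedule.Quiet S := ∀ t ≥ τ₁, S.f t = 0` (equivalently
`c₄ := 0` on every window `k ≥ 1`; the force's whole role is the preparation of the level-0/1 state on
`[0, τ₁)`). The children of the conditional-bridge crux are then

* `EpisodeBaseQ := ∃ S, S.Pins 8 (6/5) ∧ S.Rigid ∧ S.Quiet ∧ Nonempty (Stage 1 wide S m 1)`,
* `EpisodeInductionQ := ∀ S, S.Pins 8 (6/5) → S.Rigid → S.Quiet → ∀ k ≥ 1, ∀ s : Stage … k, ∃ s'`,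

with `m = Margins.withStrain (Margins.register wide)` exactly as for the v2.1 items of record
`EpisodeBaseR` / `EpisodeInductionR` (`PalasekTowerRegister.lean`, p407242), which are UNCHANGED. Quiet
only SHRINKS the schedule class, so the assembly is verbatim the v2.1 one
(`nonempty_realisation_of_episodesQ`), `EpisodeInductionR → EpisodeInductionQ` (the ∀-robust form is
superseded, not refuted: `EpisodeInductionQ.of_episodeInductionR`) and `EpisodeBaseQ → EpisodeBaseR`.
Closer: `navierStokesBreakdownR3_of_episodesQ : EpisodeBaseQ → EpisodeInductionQ → W14 → (C)` through
`palasekStep2_of_realisation` (one viscosity gives all) and the landed bridge, W14 in its Literature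
spelling via `tao2011_forced_unconditionalUniqueness_velocity.schwartzForce`.

References: S. Palasek, arXiv:2605.13827 §3.3, §4 [cite: Palasek2026ElementaryModel, §3–§4];
C. L. Fefferman, Clay problem description, (C) [cite: FeffermanClay2006, (C)]; T. Tao, Anal. PDE 6
(2013), Cor. 11.4 [cite: Tao2011, Cor. 11.4].
-/

noncomputable section

namespace Summit.NavierStokesRegularity.FluidComputer.PalasekTowerClayBridge

open Set MeasureTheory Filter Topology Function
open scoped ENNReal ContDiff NNReal
open Literature.Analysis.FluidPDE

/-! ## §1 Quiet schedules -/

/-- **A schedule is QUIET** if its force vanishes identically from the first grown readout `τ₁` on: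
the force prepares the level-0/1 state on `[0, τ₁)` and the cascade afterwards is autonomous
(REGISTER v2.2, planner WORD K45). [cite: Palasek2026ElementaryModel, §3.3] -/
def Schedule.Quiet {R : TowerRates} (S : Schedule R) : Prop :=
  ∀ t, S.τ 1 ≤ t → S.f t = 0

namespace Schedule.Quiet

variable {R : TowerRates} {S : Schedule R}

/-- Pointwise form. [folklore] -/
theorem apply (h : S.Quiet) {t : ℝ} (ht : S.τ 1 ≤ t) (x : EuclideanSpace ℝ (Fin 3)) : S.f t x = 0 := by
  rw [h t ht]
  rfl

/-- On every growth window of level `k+2` (i.e. `[τ_{k+1}, τ_{k+2}]`, `k+1 ≥ 1`) a quiet schedule's force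
is zero. [folklore] -/
theorem force_zero_on_window (h : S.Quiet) (k : ℕ) :
    ∀ t ∈ Icc (S.τ (k + 1)) (S.τ (k + 2)), ∀ x, S.f t x = 0 := by
  intro t ht x
  exact h.apply ((S.τ_mono (Nat.le_add_left 1 k)).trans ht.1) x

/-- A schedule whose force is identically zero is quiet. [folklore] -/
theorem of_force_eq_zero (hf : ∀ t, S.f t = 0) : S.Quiet := fun t _ => hf t

end Schedule.Quiet

/-! ## §2 The v2.2 children (never asserted here) -/

/-- **K1Q — the quiet episode base** (open; never asserted): a pinned (`Λ = 8`, `θ = 6/5`), rigid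
(window equality, `c₁ = 1`, `c₂ = 5/3`), QUIET schedule on the wide-base rates carries a strained,
cored stage at level `1` at unit viscosity. [cite: Palasek2026ElementaryModel, §4] -/
@[conjecture] def EpisodeBaseQ : Prop :=
  ∃ S : Schedule TowerRates.wide, S.Pins 8 (6 / 5) ∧ S.Rigid ∧ S.Quiet ∧
    Nonempty (Stage 1 TowerRates.wide S
      (Margins.withStrain (Margins.register TowerRates.wide)) 1)

/-- **K2Q — the quiet episode induction** (open; the hard piece; never asserted): over pinned, rigid,
QUIET schedules on the wide-base rates, every strained cored stage at level `k ≥ 1` extends to level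
`k+1` — AUTONOMOUS heredity (no force after `τ₁`), the intended statement of REGISTER v2.1's bet.
[cite: Palasek2026ElementaryModel, §4] -/
@[conjecture] def EpisodeInductionQ : Prop :=
  ∀ S : Schedule TowerRates.wide, S.Pins 8 (6 / 5) → S.Rigid → S.Quiet → ∀ k : ℕ, 1 ≤ k →
    ∀ s : Stage 1 TowerRates.wide S (Margins.withStrain (Margins.register TowerRates.wide)) k,
      ∃ s' : Stage 1 TowerRates.wide S (Margins.withStrain (Margins.register TowerRates.wide)) (k + 1),
        s.Extends s'

/-! ## §3 Assembly, comparison with v2.1, closer -/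

/-- **K1Q ∧ K2Q ⇒ the interface is inhabited at unit viscosity** (verbatim the v2.1 assembly: the
quiet pinned rigid schedule of K1Q is fed to K2Q and the landed gluing `Realisation.ofEpisodes`
applies). [cite: Palasek2026ElementaryModel, §4] -/
theorem nonempty_realisation_of_episodesQ (h₁ : EpisodeBaseQ) (h₂ : EpisodeInductionQ) :
    Nonempty (Realisation 1 TowerRates.wide) := by
  obtain ⟨S, hP, hR, hQ, ⟨s₁⟩⟩ := h₁
  exact ⟨Realisation.ofEpisodes S s₁ (fun n s => h₂ S hP hR hQ (n + 1) (by omega) s)⟩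

/-- Quiet only shrinks the class: the v2.1 ∀-robust induction implies the quiet one (the robust form is
SUPERSEDED by v2.2, not refuted). [folklore] -/
theorem EpisodeInductionQ.of_episodeInductionR (h : EpisodeInductionR) : EpisodeInductionQ :=
  fun S hP _ _ k hk s => h S hP k hk s

/-- … and the quiet base implies the v2.1 base. [folklore] -/
theorem EpisodeBaseQ.episodeBaseR (h : EpisodeBaseQ) : EpisodeBaseR := by
  obtain ⟨S, hP, _, _, hs⟩ := h
  exact ⟨S, hP, hs⟩

/-- The rigidity hypothesis of K2Q is redundant given the stage (the registered margin carries it);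
recorded so that skeleton writers may drop it. [folklore] -/
theorem EpisodeInductionQ.of_noRigid
    (h : ∀ S : Schedule TowerRates.wide, S.Pins 8 (6 / 5) → S.Quiet → ∀ k : ℕ, 1 ≤ k →
      ∀ s : Stage 1 TowerRates.wide S (Margins.withStrain (Margins.register TowerRates.wide)) k,
        ∃ s' : Stage 1 TowerRates.wide S (Margins.withStrain (Margins.register TowerRates.wide))
          (k + 1), s.Extends s') :
    EpisodeInductionQ :=
  fun S hP _ hQ k hk s => h S hP hQ k hk s

/-- K1Q ∧ K2Q ⇒ Palasek's Step 2 for the wide-base rates (all viscosities). [cite: Palasek2026ElementaryModel, §4] -/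
theorem palasekStep2_of_episodesQ (h₁ : EpisodeBaseQ) (h₂ : EpisodeInductionQ) :
    PalasekStep2 TowerRates.wide := by
  obtain ⟨W⟩ := nonempty_realisation_of_episodesQ h₁ h₂
  exact palasekStep2_of_realisation one_pos W

/-- **CLOSER (v2.2 children).** K1Q → K2Q → W14 → Fefferman's (C), W14 being the Literature named
fact `tao2011_forced_unconditionalUniqueness_velocity` (UNPROVED; hypothesis) fed through
`.schwartzForce` to the landed bridge. Conditional on all three; none is asserted.
[cite: FeffermanClay2006, (C)] [cite: Tao2011, Cor. 11.4] -/
theorem navierStokesBreakdownR3_of_episodesQ (h₁ : EpisodeBaseQ) (h₂ : EpisodeInductionQ)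
    (hU : tao2011_forced_unconditionalUniqueness_velocity) :
    Summit.NavierStokesRegularity.NavierStokesRegularity.NavierStokesBreakdownR3 :=
  navierStokesBreakdownR3_of_step2 TowerRates.wide
    (tao2011_forced_unconditionalUniqueness_velocity.schwartzForce hU)
    (palasekStep2_of_episodesQ h₁ h₂)

end Summit.NavierStokesRegularity.FluidComputer.PalasekTowerClayBridge

end
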